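import Literature.LinearAlgebra.QuadraticForm.KashiwaraIndexWitt
import Literature.LinearAlgebra.QuadraticForm.MaslovIndexReduction
import Literature.LinearAlgebra.QuadraticForm.SymplecticReduction
import HarnessLib

/-!
# The Kashiwara index in the Witt group: vanishing lemma and symplectic reduction
# ([LionVergne1980, 1.5.10–1.5.11, Appendix A.7 e)])

Topic `LinearAlgebra/QuadraticForm`; namespace `Literature.LinearAlgebra.QuadraticForm`. KERNEL mathematics only
(theorems + private plumbing; no named fact, no `axiom`, no `sorry`). Continues `KashiwaraIndexWitt.lean` (A.7 d)
in `W_k`) with the last algebraic item of [LionVergne1980, Appendix A.7]: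
"e) Let `ρ ⊂ ℓ₁ ∩ ℓ₂ + ℓ₂ ∩ ℓ₃ + ℓ₃ ∩ ℓ₁`. Then `τ(ℓ₁^ρ, ℓ₂^ρ, ℓ₃^ρ) = τ(ℓ₁, ℓ₂, ℓ₃)`" (in `W_k`; "with the same
notation and proofs as in 1.5"). The signature versions (`K` ordered) are `MaslovIndexVanishing.lean` (1.5.11),
`MaslovIndexReduction.lean` (1.5.10 in `V`) and `SymplecticReduction.lean` (1.5.10 in `ρ^⊥/ρ`); this file replays
the printed proofs at the level of the Witt-class relation `WittEquivalent` / `HasLagrangian`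
(`WittEquivalence.lean`, [Knebusch2010, §1.2, §1.6]):

* §1 [LionVergne1980, 1.5.11]: `ℓ₁` Lagrangian, `ℓ, ℓ₂` isotropic, `ℓ = (ℓ ∩ ℓ₁) + (ℓ ∩ ℓ₂)` ⇒ `Q(ℓ₁, ℓ, ℓ₂)` has a
  Lagrangian (`hasLagrangian_kashiwaraForm_of_le_inf_sup_inf`): as printed, `Q` is the pull-back of the pairing
  `B(y₂, y₁)` on `ℓ₂ ⊕ ℓ₁` along a linear surjection, and that pairing has the Lagrangian `(ℓ₂ ∩ ℓ₁) ⊕ ℓ₁`.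
* §2 [LionVergne1980, 1.5.10 / A.7 e)] in `V`: `Q(ℓ₁^ρ, ℓ₂^ρ, ℓ₃^ρ) ∼ Q(ℓ₁, ℓ₂, ℓ₃)`
  (`kashiwaraForm_wittEquivalent_lagrangianReduction`; one plane at a time via A.7 d) with fourth plane `ℓ₁^ρ`,
  §1 twice, A.7 b) and the cyclic symmetry `kashiwaraForm_equivalent_cycle`).
* §3 in `ρ^⊥/ρ`: pull-back along a linear surjection does not change the Witt class
  (`WittEquivalent.comp_of_surjective`: `P ∘ π ≅ P ⊥ s × [0]`, [Knebusch2010, §1.6 Def. 1.74]), hence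
  `Q(ℓ₁, ℓ₂, ℓ₃) ∼ Q_{ρ^⊥/ρ}(ℓ₁^ρ/ρ, ℓ₂^ρ/ρ, ℓ₃^ρ/ρ)` (`kashiwaraForm_wittEquivalent_reducedSubspace`).
Characteristic `0` throughout §2–§3 (inherited from `KashiwaraIndexWitt.lean`).

## References

* [LionVergne1980] G. Lion, M. Vergne, *The Weil representation, Maslov index and Theta series*, Progress in
  Mathematics 6, Birkhäuser (1980), Part I §1.5.3, §1.5.9–1.5.11; Appendix to Part I, A.7 e).
* [Knebusch2010] M. Knebusch, *Specialization of Quadratic and Symmetric Bilinear Forms*, Springer (2010), Ch. 1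
  §1.2, §1.6 Def. 1.74 — through `WittEquivalence.lean`.
-/

set_option autoImplicit false

noncomputable section

open QuadraticMap Module

namespace Literature.LinearAlgebra.QuadraticForm

universe u v w

variable {K : Type u} [Field K]
variable {V : Type v} [AddCommGroup V] [Module K V]

/-! ## §0 Plumbing: negatives of equivalences, the cyclic symmetry as an equivalence -/

/-- negation of an isometry equivalence (plumbing). [folklore] -/
private def negIsometryEquiv' {M₁ M₂ : Type*} [AddCommGroup M₁] [Module K M₁] [AddCommGroup M₂] [Module K M₂]
    {Q₁ : QuadraticForm K M₁} {Q₂ : QuadraticForm K M₂} (e : Q₁.IsometryEquiv Q₂) :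
    (-Q₁).IsometryEquiv (-Q₂) where
  toLinearEquiv := e.toLinearEquiv
  map_app' x := by
    change (-Q₂) (e x) = (-Q₁) x
    rw [QuadraticMap.neg_apply, QuadraticMap.neg_apply, e.map_app]

/-- `Q₁ ≅ Q₂ ⇒ −Q₁ ≅ −Q₂` (plumbing). [folklore] -/
private theorem equivalent_neg {M₁ M₂ : Type*} [AddCommGroup M₁] [Module K M₁] [AddCommGroup M₂] [Module K M₂]
    {Q₁ : QuadraticForm K M₁} {Q₂ : QuadraticForm K M₂} (h : Q₁.Equivalent Q₂) : (-Q₁).Equivalent (-Q₂) := by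
  obtain ⟨e⟩ := h
  exact ⟨negIsometryEquiv' e⟩

/-- **cyclic symmetry of Kashiwara's form as an ISOMETRY class**: `Q(ℓ₂, ℓ₃, ℓ₁) ≅ Q(ℓ₁, ℓ₂, ℓ₃)` (`B` alternating;
two transpositions, A.7 b)). [cite: LionVergne1980, §1.5.3; Appendix A.7 b)] -/
theorem kashiwaraForm_equivalent_cycle {B : LinearMap.BilinForm K V} (hB : LinearMap.IsAlt B)
    (ℓ₁ ℓ₂ ℓ₃ : Submodule K V) :
    (kashiwaraForm B ℓ₂ ℓ₃ ℓ₁).Equivalent (kashiwaraForm B ℓ₁ ℓ₂ ℓ₃) := by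
  have a := kashiwaraForm_equivalent_neg_swap₂₃ hB ℓ₂ ℓ₁ ℓ₃
  have b := equivalent_neg (kashiwaraForm_equivalent_neg_swap₁₂ hB ℓ₁ ℓ₂ ℓ₃)
  rw [neg_neg] at b
  exact a.trans b

/-! ## §1 [LionVergne1980, 1.5.11] at the Witt level -/

/-- if `A + C = W` then `A` has a complement `D ⊆ C` (take a complement of `A ∩ C` in `C`). [folklore] -/
private theorem exists_isCompl_le' {W : Type w} [AddCommGroup W] [Module K W] (A C : Submodule K W)
    (h : A ⊔ C = ⊤) : ∃ D : Submodule K W, D ≤ C ∧ IsCompl A D := by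
  obtain ⟨D₀, hD₀⟩ := (Submodule.comap C.subtype A).exists_isCompl
  refine ⟨D₀.map C.subtype, Submodule.map_subtype_le C D₀, ?_, ?_⟩
  · rw [Submodule.disjoint_def]
    rintro x hxA ⟨d, hd, rfl⟩
    have hd' : d ∈ Submodule.comap C.subtype A ⊓ D₀ := ⟨hxA, hd⟩
    rw [hD₀.inf_eq_bot, Submodule.mem_bot] at hd'
    simp [hd']
  · rw [codisjoint_iff, eq_top_iff]
    rintro x -
    have hx : x ∈ A ⊔ C := h ▸ Submodule.mem_top
    obtain ⟨a, ha, c, hc, rfl⟩ := Submodule.mem_sup.1 hx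
    have hc' : (⟨c, hc⟩ : C) ∈ Submodule.comap C.subtype A ⊔ D₀ := hD₀.sup_eq_top ▸ Submodule.mem_top
    obtain ⟨e, he, d, hd, hed⟩ := Submodule.mem_sup.1 hc'
    have hc'' : c = (e : W) + (d : W) := by
      rw [← Submodule.coe_add, hed]
    rw [hc'', ← add_assoc]
    exact Submodule.add_mem_sup (A.add_mem ha he) ⟨d, hd, rfl⟩

/-- the pairing `((y₂, y₁), (y₂', y₁')) ↦ B(y₂, y₁')` on `ℓ₂ × ℓ₁` ("the quadratic form `B(y₂, y₁)` on
`ℓ₂ ⊕ ℓ₁`" of the printed proof). [cite: LionVergne1980, §1.5.11, proof] -/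
private def pairingBilin (B : LinearMap.BilinForm K V) (ℓ₂ ℓ₁ : Submodule K V) :
    LinearMap.BilinForm K (ℓ₂ × ℓ₁) :=
  B.compl₁₂ (ℓ₂.subtype ∘ₗ LinearMap.fst K ℓ₂ ℓ₁) (ℓ₁.subtype ∘ₗ LinearMap.snd K ℓ₂ ℓ₁)

/-- unfolding. [folklore] -/
private theorem pairingBilin_apply (B : LinearMap.BilinForm K V) (ℓ₂ ℓ₁ : Submodule K V) (x y : ℓ₂ × ℓ₁) :
    pairingBilin B ℓ₂ ℓ₁ x y = B (x.1 : V) (y.2 : V) := rfl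

/-- "is obviously zero" in `W_k`: the pairing form `B(y₂, y₁)` on `ℓ₂ ⊕ ℓ₁` has the Lagrangian `(ℓ₂ ∩ ℓ₁) ⊕ ℓ₁` when
`ℓ₁^⊥ = ℓ₁` (`B` reflexive). [cite: LionVergne1980, §1.5.11, proof] -/
private theorem hasLagrangian_pairing {B : LinearMap.BilinForm K V} (hR : B.IsRefl) {ℓ₁ : Submodule K V}
    (h₁ : B.orthogonal ℓ₁ = ℓ₁) (ℓ₂ : Submodule K V) :
    HasLagrangian (pairingBilin B ℓ₂ ℓ₁).toQuadraticMap := by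
  have iso₁ := isotropic_of_orthogonal_eq_self h₁
  refine ⟨(ℓ₁.comap ℓ₂.subtype).prod ⊤, ?_, fun p hp => ?_⟩
  · ext p
    simp only [LinearMap.BilinForm.mem_orthogonal_iff, polarForm_apply, LinearMap.BilinMap.polar_toQuadraticMap,
      pairingBilin_apply, Submodule.mem_prod, Submodule.mem_comap, Submodule.subtype_apply, Submodule.mem_top,
      and_true]
    constructor
    · intro H
      have hp : (p.1 : V) ∈ B.orthogonal ℓ₁ := by
        rw [LinearMap.BilinForm.mem_orthogonal_iff]
        intro n hn
        have e := H (0, ⟨n, hn⟩) (by simp)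
        simp only [Submodule.coe_zero, map_zero, LinearMap.zero_apply, zero_add] at e
        exact hR _ _ e
      rwa [h₁] at hp
    · intro H q hq
      rw [iso₁ _ hq _ (p.2).2, iso₁ _ H _ (q.2).2, add_zero]
  · rw [Submodule.mem_prod, Submodule.mem_comap, Submodule.subtype_apply] at hp
    rw [LinearMap.BilinMap.toQuadraticMap_apply, pairingBilin_apply]
    exact iso₁ _ hp.1 _ (p.2).2

/-- **[LionVergne1980, 1.5.11 Lemma] in `W_k`.** Let `B` be alternating, `ℓ₁` Lagrangian (`ℓ₁^⊥ = ℓ₁`), `ℓ, ℓ₂`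
isotropic, and `ℓ = (ℓ ∩ ℓ₁) + (ℓ ∩ ℓ₂)`. Then Kashiwara's form `Q(ℓ₁, ℓ, ℓ₂)` has a Lagrangian (its Witt class is
`0`: "`τ(ℓ₁, ℓ, ℓ₂) = 0`"). Printed proof: with `x = y₁ + y₂`, `yᵢ ∈ ℓ ∩ ℓᵢ` chosen linearly,
`Q(x₁ + x + x₂) = B(x₂ − y₂, x₁ − y₁)`, the pull-back of the pairing `B(y₂, y₁)` on `ℓ₂ ⊕ ℓ₁` along a surjection.
[cite: LionVergne1980, §1.5.11] -/
theorem hasLagrangian_kashiwaraForm_of_le_inf_sup_inf {B : LinearMap.BilinForm K V} (hB : LinearMap.IsAlt B)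
    {ℓ₁ ℓ ℓ₂ : Submodule K V} (h₁ : B.orthogonal ℓ₁ = ℓ₁) (iso : ∀ x ∈ ℓ, ∀ y ∈ ℓ, B x y = 0)
    (iso₂ : ∀ x ∈ ℓ₂, ∀ y ∈ ℓ₂, B x y = 0) (hℓ : ℓ ≤ ℓ ⊓ ℓ₁ ⊔ ℓ ⊓ ℓ₂) :
    HasLagrangian (kashiwaraForm B ℓ₁ ℓ ℓ₂) := by
  have iso₁ := isotropic_of_orthogonal_eq_self h₁
  -- `Y₁ = ℓ ∩ ℓ₁` and `Y₂ ⊆ ℓ ∩ ℓ₂` complementary inside `ℓ`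
  set A : Submodule K ℓ := (ℓ ⊓ ℓ₁).comap ℓ.subtype with hA
  set C : Submodule K ℓ := (ℓ ⊓ ℓ₂).comap ℓ.subtype with hC
  have hAC : A ⊔ C = ⊤ := by
    rw [eq_top_iff]
    rintro w -
    obtain ⟨u, hu, v, hv, huv⟩ := Submodule.mem_sup.1 (hℓ w.2)
    have hw : w = (⟨u, hu.1⟩ : ℓ) + ⟨v, hv.1⟩ := Subtype.ext huv.symm
    rw [hw]
    exact Submodule.add_mem_sup (show (⟨u, hu.1⟩ : ℓ) ∈ A from hu) (show (⟨v, hv.1⟩ : ℓ) ∈ C from hv)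
  obtain ⟨D, hDC, hAD⟩ := exists_isCompl_le' A C hAC
  -- the two components `u = π₁ w ∈ ℓ ∩ ℓ₁`, `v = π₂ w ∈ ℓ ∩ ℓ₂` of `w ∈ ℓ`
  set U : ℓ →ₗ[K] ℓ₁ := LinearMap.codRestrict ℓ₁ (ℓ.subtype ∘ₗ A.subtype ∘ₗ A.projectionOnto D hAD)
    (fun w => (Submodule.mem_inf.1 (A.projectionOnto D hAD w).2).2) with hU
  set W : ℓ →ₗ[K] ℓ₂ := LinearMap.codRestrict ℓ₂ (ℓ.subtype ∘ₗ D.subtype ∘ₗ D.projectionOnto A hAD.symm)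
    (fun w => (Submodule.mem_inf.1 (hDC (D.projectionOnto A hAD.symm w).2)).2) with hW
  have hUV : ∀ w : ℓ, (U w : V) = ((A.projectionOnto D hAD w : ℓ) : V) := fun w => rfl
  have hWV : ∀ w : ℓ, (W w : V) = ((D.projectionOnto A hAD.symm w : ℓ) : V) := fun w => rfl
  have hsum : ∀ w : ℓ, (w : V) = (U w : V) + (W w : V) := fun w => by
    rw [hUV, hWV, ← Submodule.coe_add, Submodule.coe_projectionOnto_apply, Submodule.coe_projectionOnto_apply,
      Submodule.projection_add_projection_eq_self]
  have hUℓ : ∀ w : ℓ, (U w : V) ∈ ℓ := fun w => by rw [hUV]; exact SetLike.coe_mem _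
  have hWℓ : ∀ w : ℓ, (W w : V) ∈ ℓ := fun w => by rw [hWV]; exact SetLike.coe_mem _
  -- the surjection `(x₁, w, x₂) ↦ (x₂ - v, x₁ - u)`
  set g : (ℓ₁ × ℓ × ℓ₂) →ₗ[K] (ℓ₂ × ℓ₁) :=
    ((LinearMap.snd K ℓ ℓ₂ ∘ₗ LinearMap.snd K ℓ₁ (ℓ × ℓ₂)) -
        W ∘ₗ LinearMap.fst K ℓ ℓ₂ ∘ₗ LinearMap.snd K ℓ₁ (ℓ × ℓ₂)).prod
      (LinearMap.fst K ℓ₁ (ℓ × ℓ₂) - U ∘ₗ LinearMap.fst K ℓ ℓ₂ ∘ₗ LinearMap.snd K ℓ₁ (ℓ × ℓ₂)) with hg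
  have g_apply : ∀ x : ℓ₁ × ℓ × ℓ₂, g x = (x.2.2 - W x.2.1, x.1 - U x.2.1) := fun x => rfl
  have hsurj : Function.Surjective g := fun p =>
    ⟨(p.2, 0, p.1), by rw [g_apply]; simp⟩
  -- `Q` is the pull-back of the pairing along `g`
  have key : kashiwaraForm B ℓ₁ ℓ ℓ₂ = (pairingBilin B ℓ₂ ℓ₁).toQuadraticMap.comp g := by
    ext x
    obtain ⟨x₁, w, x₂⟩ := x
    rw [kashiwaraForm_apply, QuadraticMap.comp_apply, LinearMap.BilinMap.toQuadraticMap_apply, pairingBilin_apply,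
      g_apply]
    change B (x₁ : V) (w : V) + B (w : V) (x₂ : V) + B (x₂ : V) (x₁ : V) =
      B ((x₂ - W w : ℓ₂) : V) ((x₁ - U w : ℓ₁) : V)
    rw [Submodule.coe_sub, Submodule.coe_sub, hsum w]
    have f₁ : B (x₁ : V) (U w : V) = 0 := iso₁ _ x₁.2 _ (U w).2
    have f₂ : B (W w : V) (x₂ : V) = 0 := iso₂ _ (W w).2 _ x₂.2
    have f₃ : B (W w : V) (U w : V) = 0 := iso _ (hWℓ w) _ (hUℓ w)
    have a₁ : B (x₂ : V) (U w : V) = -B (U w : V) (x₂ : V) := (hB.neg _ _).symm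
    have a₂ : B (W w : V) (x₁ : V) = -B (x₁ : V) (W w : V) := (hB.neg _ _).symm
    simp only [map_add, map_sub, LinearMap.add_apply, LinearMap.sub_apply]
    linear_combination f₁ + f₂ - f₃ + a₁ + a₂
  rw [key]
  exact (hasLagrangian_pairing hB.isRefl h₁ ℓ₂).comp_of_surjective g hsurj

/-! ## §2 [LionVergne1980, 1.5.10 / A.7 e)] in `V`, at the Witt level -/

section Reduction

variable [FiniteDimensional K V] {B : LinearMap.BilinForm K V} {ℓ₁ ℓ₂ ℓ₃ : Submodule K V}

/-- "`τ(ℓ₁, ℓ₁^ρ, ℓⱼ) = 0`" in `W_k` (by §1), for any Lagrangian `T ⊃ ℓ₂ ∩ ℓ₃` in the third slot.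
[cite: LionVergne1980, §1.5.10, proof] -/
private theorem hasLagrangian_self_lagrangianReduction (hB : LinearMap.IsAlt B) (hN : B.Nondegenerate)
    (h₁ : B.orthogonal ℓ₁ = ℓ₁) (h₂ : B.orthogonal ℓ₂ = ℓ₂) (h₃ : B.orthogonal ℓ₃ = ℓ₃) {ρ : Submodule K V}
    (hρ : ρ ≤ ℓ₁ ⊓ ℓ₂ ⊔ ℓ₂ ⊓ ℓ₃ ⊔ ℓ₃ ⊓ ℓ₁) {T : Submodule K V} (hT : B.orthogonal T = T)
    (hT' : ℓ₂ ⊓ ℓ₃ ≤ T) :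
    HasLagrangian (kashiwaraForm B ℓ₁ (lagrangianReduction B ρ ℓ₁) T) := by
  have hρiso : ρ ≤ B.orthogonal ρ := hρ.trans (pairwiseInfSum_le_orthogonal_of_le h₁ h₂ h₃ hρ)
  have hL := orthogonal_lagrangianReduction_eq_self hN hB.isRefl hρiso h₁
  exact hasLagrangian_kashiwaraForm_of_le_inf_sup_inf hB h₁ (isotropic_of_orthogonal_eq_self hL)
    (isotropic_of_orthogonal_eq_self hT) (lagrangianReduction_le_inf_sup_inf h₁ h₂ h₃ hρ hT')

/-- **the one-plane step `Q(ℓ₁, ℓ₂, ℓ₃) ∼ Q(ℓ₁^ρ, ℓ₂, ℓ₃)`**: A.7 d) with fourth plane `ℓ₁^ρ`, in which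
`Q(ℓ₁, ℓ₂, ℓ₁^ρ)` and `Q(ℓ₃, ℓ₁, ℓ₁^ρ)` are split (§1 and A.7 b)), then the cyclic symmetry.
[cite: LionVergne1980, §1.5.10, proof; Appendix A.7 e)] -/
theorem kashiwaraForm_wittEquivalent_lagrangianReduction_left [CharZero K] (hB : LinearMap.IsAlt B) (hN : B.Nondegenerate)
    (h₁ : B.orthogonal ℓ₁ = ℓ₁) (h₂ : B.orthogonal ℓ₂ = ℓ₂) (h₃ : B.orthogonal ℓ₃ = ℓ₃) {ρ : Submodule K V}
    (hρ : ρ ≤ ℓ₁ ⊓ ℓ₂ ⊔ ℓ₂ ⊓ ℓ₃ ⊔ ℓ₃ ⊓ ℓ₁) :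
    WittEquivalent (kashiwaraForm B ℓ₁ ℓ₂ ℓ₃) (kashiwaraForm B (lagrangianReduction B ρ ℓ₁) ℓ₂ ℓ₃) := by
  set R := lagrangianReduction B ρ ℓ₁ with hR
  have hρiso : ρ ≤ B.orthogonal ρ := hρ.trans (pairwiseInfSum_le_orthogonal_of_le h₁ h₂ h₃ hρ)
  have hL : B.orthogonal R = R := orthogonal_lagrangianReduction_eq_self hN hB.isRefl hρiso h₁
  -- A.7 d) with fourth plane `R = ℓ₁^ρ`
  have chain := kashiwaraForm_wittEquivalent_chain hB hN h₁ h₂ h₃ hL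
  -- `Q(ℓ₁, R, ℓ₂)` and `Q(ℓ₁, R, ℓ₃)` are split (1.5.11)
  have v₂ : HasLagrangian (kashiwaraForm B ℓ₁ R ℓ₂) :=
    hasLagrangian_self_lagrangianReduction hB hN h₁ h₂ h₃ hρ h₂ inf_le_left
  have v₃ : HasLagrangian (kashiwaraForm B ℓ₁ R ℓ₃) :=
    hasLagrangian_self_lagrangianReduction hB hN h₁ h₂ h₃ hρ h₃ inf_le_right
  -- hence so are `Q(ℓ₁, ℓ₂, R) ≅ -Q(ℓ₁, R, ℓ₂)` and `Q(ℓ₃, ℓ₁, R) ≅ Q(ℓ₁, R, ℓ₃)`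
  have z₁ : HasLagrangian (kashiwaraForm B ℓ₁ ℓ₂ R) :=
    v₂.neg.of_equivalent (kashiwaraForm_equivalent_neg_swap₂₃ hB ℓ₁ R ℓ₂).symm
  have z₃ : HasLagrangian (kashiwaraForm B ℓ₃ ℓ₁ R) := by
    have e₁ := kashiwaraForm_equivalent_neg_swap₁₂ hB ℓ₁ ℓ₃ R
    have e₂ := equivalent_neg (kashiwaraForm_equivalent_neg_swap₂₃ hB ℓ₁ R ℓ₃)
    rw [neg_neg] at e₂
    exact v₃.of_equivalent (e₁.trans e₂).symm
  -- absorb the two split summands, then rotate `Q(ℓ₂, ℓ₃, R) ≅ Q(R, ℓ₂, ℓ₃)`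
  have a : WittEquivalent ((kashiwaraForm B ℓ₁ ℓ₂ R).prod ((kashiwaraForm B ℓ₂ ℓ₃ R).prod
      (kashiwaraForm B ℓ₃ ℓ₁ R))) (kashiwaraForm B ℓ₂ ℓ₃ R) :=
    ((wittEquivalent_prod_comm _ _).trans (WittEquivalent.prod_of_hasLagrangian _ z₁)).trans
      (WittEquivalent.prod_of_hasLagrangian _ z₃)
  exact (chain.trans a).trans (WittEquivalent.of_equivalent (kashiwaraForm_equivalent_cycle hB R ℓ₂ ℓ₃))

/-- **[LionVergne1980, A.7 e) / 1.5.10 Proposition] in the Witt group.** Let `B` be alternating and nondegenerate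
on the finite-dimensional `V` over a field of characteristic `0`, `ℓ₁, ℓ₂, ℓ₃` Lagrangian and
`ρ ⊂ (ℓ₁ ∩ ℓ₂) + (ℓ₂ ∩ ℓ₃) + (ℓ₃ ∩ ℓ₁)`. Then `Q(ℓ₁^ρ, ℓ₂^ρ, ℓ₃^ρ) ∼ Q(ℓ₁, ℓ₂, ℓ₃)`
("`τ(ℓ₁^ρ, ℓ₂^ρ, ℓ₃^ρ) = τ(ℓ₁, ℓ₂, ℓ₃)`" in `W_k`; reductions `ℓᵢ^ρ = (ℓᵢ ∩ ρ^⊥) + ρ` inside `V`, see §3 for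
`ρ^⊥/ρ`). [cite: LionVergne1980, Appendix A.7 e); §1.5.10] -/
theorem kashiwaraForm_wittEquivalent_lagrangianReduction [CharZero K] (hB : LinearMap.IsAlt B) (hN : B.Nondegenerate)
    (h₁ : B.orthogonal ℓ₁ = ℓ₁) (h₂ : B.orthogonal ℓ₂ = ℓ₂) (h₃ : B.orthogonal ℓ₃ = ℓ₃) {ρ : Submodule K V}
    (hρ : ρ ≤ ℓ₁ ⊓ ℓ₂ ⊔ ℓ₂ ⊓ ℓ₃ ⊔ ℓ₃ ⊓ ℓ₁) :
    WittEquivalent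
      (kashiwaraForm B (lagrangianReduction B ρ ℓ₁) (lagrangianReduction B ρ ℓ₂) (lagrangianReduction B ρ ℓ₃))
      (kashiwaraForm B ℓ₁ ℓ₂ ℓ₃) := by
  have hρiso : ρ ≤ B.orthogonal ρ := hρ.trans (pairwiseInfSum_le_orthogonal_of_le h₁ h₂ h₃ hρ)
  have L₁ := orthogonal_lagrangianReduction_eq_self hN hB.isRefl hρiso h₁
  have L₂ := orthogonal_lagrangianReduction_eq_self hN hB.isRefl hρiso h₂
  set R₁ := lagrangianReduction B ρ ℓ₁
  set R₂ := lagrangianReduction B ρ ℓ₂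
  set R₃ := lagrangianReduction B ρ ℓ₃
  -- step 1: `ℓ₁ ↦ ℓ₁^ρ`
  have e₁ := kashiwaraForm_wittEquivalent_lagrangianReduction_left hB hN h₁ h₂ h₃ hρ
  -- step 2: `ℓ₂ ↦ ℓ₂^ρ` in the triple `(ℓ₂, ℓ₃, ℓ₁^ρ)`
  have hρ₂ := le_pairwiseInfSum_lagrangianReduction h₁ h₂ h₃ hρ
  have e₂ := kashiwaraForm_wittEquivalent_lagrangianReduction_left hB hN h₂ h₃ L₁ hρ₂
  -- step 3: `ℓ₃ ↦ ℓ₃^ρ` in the triple `(ℓ₃, ℓ₁^ρ, ℓ₂^ρ)` (now `ρ ⊂ ℓ₁^ρ ∩ ℓ₂^ρ`)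
  have hρ₃ : ρ ≤ ℓ₃ ⊓ R₁ ⊔ R₁ ⊓ R₂ ⊔ R₂ ⊓ ℓ₃ :=
    le_sup_of_le_left (le_sup_of_le_right
      (le_inf (le_lagrangianReduction B ρ ℓ₁) (le_lagrangianReduction B ρ ℓ₂)))
  have e₃ := kashiwaraForm_wittEquivalent_lagrangianReduction_left hB hN h₃ L₁ L₂ hρ₃
  -- cyclic rotations between the steps
  have c₁ := WittEquivalent.of_equivalent (kashiwaraForm_equivalent_cycle hB R₁ ℓ₂ ℓ₃).symm
  have c₂ := WittEquivalent.of_equivalent (kashiwaraForm_equivalent_cycle hB R₂ ℓ₃ R₁).symm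
  have c₃ := WittEquivalent.of_equivalent (kashiwaraForm_equivalent_cycle hB R₃ R₁ R₂).symm
  exact (e₁.trans (c₁.trans (e₂.trans (c₂.trans (e₃.trans c₃))))).symm

end Reduction

/-! ## §3 In the reduced space `ρ^⊥/ρ` -/

/-- `P ⊕ 0 ≅ P` for the zero form on the zero space `Fin 0 → K` (plumbing). [folklore] -/
private def prodZeroEquiv' (P : QuadraticForm K V) :
    (P.prod (0 : QuadraticForm K (Fin 0 → K))).IsometryEquiv P where
  toLinearEquiv :=
    { toFun := Prod.fst
      invFun := fun v => (v, 0)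
      map_add' := fun _ _ => rfl
      map_smul' := fun _ _ => rfl
      left_inv := fun p => Prod.ext rfl (Subsingleton.elim _ _)
      right_inv := fun _ => rfl }
  map_app' p := by
    change P p.1 = (P.prod 0) p
    rw [QuadraticMap.prod_apply, QuadraticMap.zero_apply, add_zero]

/-- **pull-back along a linear surjection does not change the Witt class**: `P ∘ π ∼ P`, because
`P ∘ π ≅ P ⊥ (dim ker π) × [0]` (split `W = C ⊕ ker π` with `π|_C` an isomorphism).
[cite: Knebusch2010, §1.6 Def. 1.74 (`M ≅ M̂ ⊥ s × [0]`)] -/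
theorem WittEquivalent.comp_of_surjective {W : Type w} [AddCommGroup W] [Module K W] [FiniteDimensional K W]
    (P : QuadraticForm K V) (π : W →ₗ[K] V) (hπ : Function.Surjective π) :
    WittEquivalent (P.comp π) P := by
  obtain ⟨C, hC⟩ := (LinearMap.ker π).exists_isCompl
  -- `π|_C : C ≃ V`
  have hinj : Function.Injective (π.domRestrict C) := by
    intro x y hxy
    have hmem : (x : W) - y ∈ LinearMap.ker π ⊓ C :=
      Submodule.mem_inf.2 ⟨by rw [LinearMap.mem_ker, map_sub, sub_eq_zero]; exact hxy, C.sub_mem x.2 y.2⟩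
    rw [hC.inf_eq_bot, Submodule.mem_bot, sub_eq_zero] at hmem
    exact Subtype.ext hmem
  have hsurj : Function.Surjective (π.domRestrict C) := by
    intro v
    obtain ⟨w, rfl⟩ := hπ v
    have hw : w ∈ LinearMap.ker π ⊔ C := hC.sup_eq_top ▸ Submodule.mem_top
    obtain ⟨k, hk, c, hc, rfl⟩ := Submodule.mem_sup.1 hw
    exact ⟨⟨c, hc⟩, by rw [LinearMap.domRestrict_apply, map_add, LinearMap.mem_ker.1 hk, zero_add]⟩
  set e : C ≃ₗ[K] V := LinearEquiv.ofBijective (π.domRestrict C) ⟨hinj, hsurj⟩ with he_def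
  have he : ∀ c : C, e c = π (c : W) := fun c => rfl
  -- `P ⊕ 0_{ker π} ≅ P ∘ π` through `(v, k) ↦ (π|_C)⁻¹ v + k`
  set f : (V × LinearMap.ker π) ≃ₗ[K] W :=
    (e.symm.prodCongr (LinearEquiv.refl K (LinearMap.ker π))).trans
      (Submodule.prodEquivOfIsCompl C (LinearMap.ker π) hC.symm) with hf_def
  have hf : ∀ p : V × LinearMap.ker π, f p = (e.symm p.1 : W) + (p.2 : W) := fun p => rfl
  have iso : (P.prod (0 : QuadraticForm K (LinearMap.ker π))).IsometryEquiv (P.comp π) :=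
    { toLinearEquiv := f
      map_app' := fun p => by
        change (P.comp π) (f p) = (P.prod 0) p
        rw [hf, QuadraticMap.comp_apply, map_add, LinearMap.mem_ker.1 p.2.2, add_zero, QuadraticMap.prod_apply,
          QuadraticMap.zero_apply, add_zero, ← he, LinearEquiv.apply_symm_apply] }
  exact WittEquivalent.intro (hasLagrangian_zero (V := Fin 0 → K)) (hasLagrangian_zero (V := LinearMap.ker π))
    ⟨(prodZeroEquiv' (P.comp π)).trans iso.symm⟩

/-- the Kashiwara form of `(ℓ₁^ρ, ℓ₂^ρ, ℓ₃^ρ)` in `V` is the pull-back of the Kashiwara form of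
`(ℓ₁^ρ/ρ, ℓ₂^ρ/ρ, ℓ₃^ρ/ρ)` in `(ρ^⊥/ρ, B̄)` along the surjection `ℓ₁^ρ ⊕ ℓ₂^ρ ⊕ ℓ₃^ρ → ℓ₁^ρ/ρ ⊕ ℓ₂^ρ/ρ ⊕ ℓ₃^ρ/ρ`,
hence has the same Witt class (`B` reflexive, `ρ` isotropic). [cite: LionVergne1980, §1.5.9–1.5.10] -/
theorem kashiwaraForm_wittEquivalent_reducedSubspace [FiniteDimensional K V] {B : LinearMap.BilinForm K V}
    (hR : B.IsRefl) {ρ : Submodule K V} (hρ : ρ ≤ B.orthogonal ρ) (ℓ₁ ℓ₂ ℓ₃ : Submodule K V) :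
    WittEquivalent
      (kashiwaraForm B (lagrangianReduction B ρ ℓ₁) (lagrangianReduction B ρ ℓ₂) (lagrangianReduction B ρ ℓ₃))
      (kashiwaraForm (reducedForm hR ρ) (reducedSubspace B ρ ℓ₁) (reducedSubspace B ρ ℓ₂)
        (reducedSubspace B ρ ℓ₃)) := by
  set π : (↥(lagrangianReduction B ρ ℓ₁) × ↥(lagrangianReduction B ρ ℓ₂) × ↥(lagrangianReduction B ρ ℓ₃)) →ₗ[K]
      (↥(reducedSubspace B ρ ℓ₁) × ↥(reducedSubspace B ρ ℓ₂) × ↥(reducedSubspace B ρ ℓ₃)) :=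
    (toReducedSubspace hρ ℓ₁).prodMap ((toReducedSubspace hρ ℓ₂).prodMap (toReducedSubspace hρ ℓ₃)) with hπ
  have hsurj : Function.Surjective π :=
    (toReducedSubspace_surjective hρ ℓ₁).prodMap
      ((toReducedSubspace_surjective hρ ℓ₂).prodMap (toReducedSubspace_surjective hρ ℓ₃))
  have key : kashiwaraForm B (lagrangianReduction B ρ ℓ₁) (lagrangianReduction B ρ ℓ₂)
      (lagrangianReduction B ρ ℓ₃) =
      (kashiwaraForm (reducedForm hR ρ) (reducedSubspace B ρ ℓ₁) (reducedSubspace B ρ ℓ₂)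
        (reducedSubspace B ρ ℓ₃)).comp π := by
    ext x
    rw [QuadraticMap.comp_apply, kashiwaraForm_apply, kashiwaraForm_apply]
    rfl
  rw [key]
  exact WittEquivalent.comp_of_surjective _ π hsurj

/-- **[LionVergne1980, A.7 e) / 1.5.10] in the reduced space:** for `B` alternating nondegenerate on the
finite-dimensional `V` (characteristic `0`), `ℓ₁, ℓ₂, ℓ₃` Lagrangian and `ρ ⊂ (ℓ₁ ∩ ℓ₂) + (ℓ₂ ∩ ℓ₃) + (ℓ₃ ∩ ℓ₁)`:
`Q(ℓ₁, ℓ₂, ℓ₃) ∼ Q_{ρ^⊥/ρ}(ℓ₁^ρ/ρ, ℓ₂^ρ/ρ, ℓ₃^ρ/ρ)`. [cite: LionVergne1980, Appendix A.7 e); §1.5.10] -/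
theorem kashiwaraForm_wittEquivalent_reducedSubspace_of_le [CharZero K] [FiniteDimensional K V]
    {B : LinearMap.BilinForm K V} (hB : LinearMap.IsAlt B) (hN : B.Nondegenerate) {ℓ₁ ℓ₂ ℓ₃ : Submodule K V}
    (h₁ : B.orthogonal ℓ₁ = ℓ₁) (h₂ : B.orthogonal ℓ₂ = ℓ₂) (h₃ : B.orthogonal ℓ₃ = ℓ₃) {ρ : Submodule K V}
    (hρ : ρ ≤ ℓ₁ ⊓ ℓ₂ ⊔ ℓ₂ ⊓ ℓ₃ ⊔ ℓ₃ ⊓ ℓ₁) :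
    WittEquivalent (kashiwaraForm B ℓ₁ ℓ₂ ℓ₃)
      (kashiwaraForm (reducedForm hB.isRefl ρ) (reducedSubspace B ρ ℓ₁) (reducedSubspace B ρ ℓ₂)
        (reducedSubspace B ρ ℓ₃)) := by
  have hρiso : ρ ≤ B.orthogonal ρ := hρ.trans (pairwiseInfSum_le_orthogonal_of_le h₁ h₂ h₃ hρ)
  exact (kashiwaraForm_wittEquivalent_lagrangianReduction hB hN h₁ h₂ h₃ hρ).symm.trans
    (kashiwaraForm_wittEquivalent_reducedSubspace hB.isRefl hρiso ℓ₁ ℓ₂ ℓ₃)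

end Literature.LinearAlgebra.QuadraticForm
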